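import Summits.BirchSwinnertonDyer.BirchSwinnertonDyer.Theorems.AlignedTransportAtTwoMainConjectureOfRankZeroBSDAtTwoCyclotomicLayerRankBudget
import Summits.BirchSwinnertonDyer.BirchSwinnertonDyer.Theorems.AlignedTransportAtTwoMainConjectureOfRankZeroBSDAtTwoEisensteinRigidityConservation
import Summits.BirchSwinnertonDyer.BirchSwinnertonDyer.Theorems.AlignedTransportAtTwoMainConjectureOfRankZeroBSDAtTwoLayerOneRankBound
import Summits.BirchSwinnertonDyer.BirchSwinnertonDyer.Theorems.AlignedTransportAtTwoMainConjectureOfRankZeroBSDAtTwoEisensteinRigidityPrime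
import HarnessLib

/-!
# Route `AlignedTransportAtTwo`, crux C2 `MainConjectureOfRankZeroBSDAtTwo` (stmt-BirchSwinnertonDyer-22298):
# THE ANALYTIC FACE (any good ordinary `p`, Kato 17.4 (1)(2)) — Mordell–Weil growth in the layer `ℚ_{n+1}/ℚ_n` of the cyclotomic `ℤ_p`-tower puts
# `Φ_{p^{n+1}}(1+T)` into the `p`-adic `L`-function: `L_p(E,T)` VANISHES AT EVERY CHARACTER OF ORDER `p^{n+1}`; the growth layers have total degree `≤ λ_an`

HONEST FRAMING (cell `bsd-f1-sign2`, WIDTH-5 attached prover seat `bsd-line-att-p5` gen 36 on line `birth` of the lead `bsd-line-att-p2`;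
`--supports` stmt-BirchSwinnertonDyer-22298, closes nothing; BSD is NOT proved by any of this; the crux C2, its verdict «blocked-on
`Rank1Residual.GreenbergMuConjectureIrreducible`» and every registered stub are untouched). THEOREMS ONLY — no `def`, no `sorry`, nothing asserted about any
curve. The ONE print binder is the lineage's `h17 : kato_divisibility_allPrimes W p` (Kato 2004, Thm. 17.4 (1)(2): `X` torsion and `pᵐ·L_p(f,α) = ι g`, `g ∈ char X`),
here at ANY prime `p` of good ordinary reduction (for odd `p` it is the tree's named fact `kato_divisibility`, `kato_divisibility_allPrimes_of_kato_divisibility`).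

THE POINT. The layer theorem / dichotomy of this gen put `Ψ_n = Φ_{p^{n+1}}(1+T)` into `char_Λ X(E/ℚ_∞) = (f_X)` whenever the rank grows in `ℚ_{n+1}/ℚ_n`;
Kato gives `f_X · a = pᵐ · G` for every integral lift `G` of `L_p(f,α)` (`ι G = L_p(f,α)`); `Ψ_n` is PRIME and does not divide the constant `pᵐ`, so
**`Ψ_n ∣ G`** — under `1 + T ↔ γ`, `L_p(E, ζ − 1) = 0` for EVERY primitive `p^{n+1}`-th root of unity `ζ` (all characters of `Gal(ℚ_{n+1}/ℚ)` of exact order `p^{n+1}`).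

* §1 `isTorsion_and_exists_charGen_mul_eq_C_pow_mul_of_kato` at any `p` (the lineage's p = 2 lemma verbatim); `not_cyclotomicLayer_dvd_C_pow`;
  `cyclotomicLayer_pow_dvd_of_dvd_C_mul` (`Ψ_n^t ∣ pᵐ·G ⇒ Ψ_n^t ∣ G`).
* §2 ★★ `cyclotomicLayer_dvd_lift_of_mordellWeilRank_lt` — **`rank W(ℚ_n) < rank W(ℚ_{n+1}) ⇒ Φ_{p^{n+1}}(1+T) ∣ G`** (dichotomy form: `mordellWeilRank_layer_succ_eq_or_cyclotomicLayer_dvd_lift`);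
  ★ `cyclotomicLayer_pow_dvd_lift_of_rank_le` — **`rank W(ℚ_n) + pⁿ(p−1)·t ≤ rank W(ℚ_{n+1}) ⇒ Φ_{p^{n+1}}(1+T)^t ∣ G`** (higher vanishing order at those characters).
* §4 (`p = 2`) `orderAtNegTwo_add_two_pow_le_lam_of_mordellWeilRank_lt` — **growth at layer `n+1 ≥ 2` ⇒ `ord_{T=−2} L₂ + 2ⁿ ≤ λ(G)`** (the `χ₈`-zero and the
  orbit of order-`2^{n+1}` zeros are distinct primes of `L₂`); `mordellWeilRank_layer_succ_eq_of_lam_lt_orderAtNegTwo_add` (contrapositive; `a₂ = −1` road, `ord = 3`).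
* §3 ★★ `sum_totient_growthLayers_le_lam_lift` — **for any finite set `S` of growth layers, `∑_{n∈S} pⁿ(p−1) ≤ λ(G)`** (`G ≠ 0` by Rohrlich, tree
  `padicLFunction_unitRoot_ne_zero`; `λ(G) = λ_an` when `μ(G)`-normalised — the count is insensitive to `μ`); `mordellWeilRank_layer_succ_eq_of_lam_lift_lt` —
  **`λ(G) < pⁿ(p−1) ⇒ rank W(ℚ_{n+1}) = rank W(ℚ_n)`**, and `mordellWeilRank_layer_eq_of_lam_lift_lt` — **stationary from the layer `n₀` with `λ(G) < p^{n₀}(p−1)` on**: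
  an EXPLICIT, COMPUTABLE (from the `p`-adic `L`-function) layer beyond which the Mordell–Weil rank of a good ordinary `E/ℚ` never grows again in `ℚ_∞` — modulo PRINT
  Kato 17.4 (1)(2) only (no main conjecture, no `μ = 0`).

References: K. Kato, Astérisque 295 (2004), Thm. 17.4 [Kato2004Asterisque]; R. Greenberg, LNM 1716 (1999), Thm. 1.9, §5 p. 132 [GreenbergLNM1716]; D. Rohrlich,
Invent. Math. 75 (1984) (non-vanishing of `L(E,χ,1)` for almost all cyclotomic `χ`) [RohrlichInventiones1984]; B. Mazur, J. Tate, J. Teitelbaum, Invent. Math. 84 (1986),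
§I.14 [MazurTateTeitelbaum1986Invent].
-/

set_option linter.dupNamespace false
set_option autoImplicit false

noncomputable section

open scoped Classical MatrixGroups ModularForm Polynomial

namespace Summit.BirchSwinnertonDyer.BirchSwinnertonDyer.Theorems.AlignedTransportAtTwoCyclotomicLayerLFunction

open PowerSeries CongruenceSubgroup WeierstrassCurve Literature.NumberTheory.EllipticCurves
  Literature.NumberTheory.EllipticCurves.ModularForms
  Literature.NumberTheory.EllipticCurves.Rank1Residual
  Literature.NumberTheory.EllipticCurves.Greenberg1999
  Summit.BirchSwinnertonDyer.Rank1Residual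
  Summit.BirchSwinnertonDyer.Rank1Residual.X1.MuLambda
  Summit.BirchSwinnertonDyer.Rank1Residual.X1.ParitySqueeze
  Summit.BirchSwinnertonDyer.Rank1Residual.Iwasawa
  Summit.BirchSwinnertonDyer.BirchSwinnertonDyer.Theorems.AlignedTransportAtTwoEisensteinRigidity
  Summit.BirchSwinnertonDyer.BirchSwinnertonDyer.Theorems.AlignedTransportAtTwoEisensteinRigidityPrime
  Summit.BirchSwinnertonDyer.BirchSwinnertonDyer.Theorems.AlignedTransportAtTwoCyclotomicLayerPrime
  Summit.BirchSwinnertonDyer.BirchSwinnertonDyer.Theorems.AlignedTransportAtTwoCyclotomicLayerRankGrowth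
  Summit.BirchSwinnertonDyer.BirchSwinnertonDyer.Theorems.AlignedTransportAtTwoCyclotomicLayerRankDichotomy
  Summit.BirchSwinnertonDyer.BirchSwinnertonDyer.Theorems.AlignedTransportAtTwoCyclotomicLayerRankBudget
  Summit.BirchSwinnertonDyer.BirchSwinnertonDyer.Theorems.DefectPrime

variable {p : ℕ} [hp : Fact p.Prime]

/-! ## §1 Kato 17.4 (1)(2) pulled back to `Λ` at any `p`; the layer prime does not divide `pᵐ` -/

variable (W : WeierstrassCurve ℚ) [W.IsElliptic] [W.IsGloballyMinimal]

omit [W.IsElliptic] in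
/-- **Kato's divisibility in `Λ`, plain lift, any `p`.** From `kato_divisibility_allPrimes W p` (`X` torsion, `pᵐ·L_p(f,α) = ι g`, `g ∈ char X`) and `ι G = L_p(f,α)`:
for a generator `f_X` of the principal characteristic ideal, `f_X · a = pᵐ · G` (`ι` is injective). The lineage's lemma of the same name is `p = 2`.
[cite: Kato2004Asterisque, Thm. 17.4 (1)(2) (p. 273)] -/
theorem isTorsion_and_exists_charGen_mul_eq_C_pow_mul_of_kato {N : ℕ} [NeZero N] {f : CuspForm (Gamma0 N) 2}
    (h17 : kato_divisibility_allPrimes W p (f := f))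
    {κ : ZpExtension ℚ p} {γ : Field.absoluteGaloisGroup ℚ} (hκ : κ.IsCyclotomic) (hγ : κ.IsTopGenerator γ)
    (hγ' : IsCyclotomicVariable p γ) (hord : IsOrdinaryAt W p) (hf : IsNewformOf W f) (D : W.SelmerDualData κ γ)
    {fX : IwasawaAlgebra p} (hchar : D.charIdeal = Ideal.span {fX}) {G : IwasawaAlgebra p}
    (hG : iwasawaToPowerSeries p G = padicLFunction f (unitRoot W p : ℚ_[p])) :
    D.IsTorsion ∧ ∃ (a : IwasawaAlgebra p) (m : ℕ), fX * a = C ((p : ℤ_[p]) ^ m) * G := by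
  obtain ⟨hD, m, g, hg, hι⟩ := h17 κ γ hκ hγ hγ' hord hf D
  refine ⟨hD, ?_⟩
  rw [hchar] at hg
  obtain ⟨a, ha⟩ := Ideal.mem_span_singleton'.mp hg
  refine ⟨a, m, ?_⟩
  have hιC : ∀ x : ℤ_[p], iwasawaToPowerSeries p (C x) = C (x : ℚ_[p]) :=
    fun x => by rw [iwasawaToPowerSeries, PowerSeries.map_C]; rfl
  apply iwasawaToPowerSeries_injective p
  rw [mul_comm, ha, hι, map_mul, hιC, hG]
  push_cast
  rfl

/-- **`Ψ_n = Φ_{p^{n+1}}(1+T)` does not divide `pᵐ`** (`λ(Ψ_n) = pⁿ(p−1) ≥ 1 > 0 = λ(pᵐ)`). [cite: Washington1997, §7.1] -/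
theorem not_cyclotomicLayer_dvd_C_pow (n m : ℕ) :
    ¬ (((Polynomial.cyclotomic (p ^ (n + 1)) ℤ_[p]).comp (Polynomial.X + 1) : ℤ_[p][X]) : PowerSeries ℤ_[p]) ∣ C ((p : ℤ_[p]) ^ m) := by
  rintro ⟨q, hq⟩
  have hC0 : (C ((p : ℤ_[p]) ^ m) : PowerSeries ℤ_[p]) ≠ 0 := by
    rw [Ne, map_eq_zero_iff _ (C_injective (R := ℤ_[p]))]
    exact pow_ne_zero _ (by exact_mod_cast hp.out.ne_zero)
  have hq0 : q ≠ 0 := by rintro rfl; exact hC0 (by rw [hq, mul_zero])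
  have hlam : lam (C ((p : ℤ_[p]) ^ m) : PowerSeries ℤ_[p]) = 0 := (lam_mu_norm_C_pow (p := p) m).1
  have h := congrArg lam hq
  rw [hlam, lam_mul (prime_coe_cyclotomic_comp p n).ne_zero hq0, lam_cyclotomicLayer] at h
  have h1 : 1 ≤ p ^ n * (p - 1) := Nat.mul_pos (pow_pos hp.out.pos n) (by have := hp.out.two_le; omega)
  omega

/-- `Ψ_n^t ∣ pᵐ·G ⇒ Ψ_n^t ∣ G` (`Ψ_n` prime, `Ψ_n ∤ pᵐ`). [cite: Washington1997, §13.2] -/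
theorem cyclotomicLayer_pow_dvd_of_dvd_C_mul (n t m : ℕ) {G : PowerSeries ℤ_[p]}
    (h : (((Polynomial.cyclotomic (p ^ (n + 1)) ℤ_[p]).comp (Polynomial.X + 1) : ℤ_[p][X]) : PowerSeries ℤ_[p]) ^ t ∣ C ((p : ℤ_[p]) ^ m) * G) :
    (((Polynomial.cyclotomic (p ^ (n + 1)) ℤ_[p]).comp (Polynomial.X + 1) : ℤ_[p][X]) : PowerSeries ℤ_[p]) ^ t ∣ G :=
  (prime_coe_cyclotomic_comp p n).pow_dvd_of_dvd_mul_left t (not_cyclotomicLayer_dvd_C_pow n m) h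

/-! ## §2 Growth at layer `n+1` puts `Φ_{p^{n+1}}(1+T)` into the `p`-adic `L`-function -/

/-- ★★ **MORDELL–WEIL GROWTH IN `ℚ_{n+1}/ℚ_n` ⇒ `Φ_{p^{n+1}}(1+T) ∣ L_p`** (dichotomy form). `W/ℚ` globally minimal, good ordinary at `p`, `f` a newform of `W` (any level)
with PRINT `h17` (Kato 17.4 (1)(2) at `p`); `G ∈ Λ` an integral lift (`ι G = L_p(f,α)`); `κ` the cyclotomic `ℤ_p`-extension with normalised topological generator `γ`. Then for every `n`:
**`rank W(ℚ_{n+1}) = rank W(ℚ_n)` OR `Φ_{p^{n+1}}(1+T) ∣ G`** — i.e. `L_p(E, ζ−1) = 0` for every primitive `p^{n+1}`-th root of unity `ζ`.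
[cite: Kato2004Asterisque, Thm. 17.4 (1)(2) (p. 273)] [cite: GreenbergLNM1716, Thm. 1.9 (p. 63) and §5 p. 132] -/
theorem mordellWeilRank_layer_succ_eq_or_cyclotomicLayer_dvd_lift {N : ℕ} [NeZero N] {f : CuspForm (Gamma0 N) 2}
    (h17 : kato_divisibility_allPrimes W p (f := f)) (hord : IsOrdinaryAt W p) (hf : IsNewformOf W f)
    {G : IwasawaAlgebra p} (hG : iwasawaToPowerSeries p G = padicLFunction f (unitRoot W p : ℚ_[p]))
    {κ : ZpExtension ℚ p} {γ : Field.absoluteGaloisGroup ℚ} (hκ : κ.IsCyclotomic) (hγ : κ.IsTopGenerator γ)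
    (hγ' : IsCyclotomicVariable p γ) (n : ℕ) :
    (W.baseChange (κ.layer (n + 1))).mordellWeilRank = (W.baseChange (κ.layer n)).mordellWeilRank ∨
      (((Polynomial.cyclotomic (p ^ (n + 1)) ℤ_[p]).comp (Polynomial.X + 1) : ℤ_[p][X]) : PowerSeries ℤ_[p]) ∣ G := by
  obtain ⟨D⟩ := W.nonempty_selmerDualData_holds κ γ hγ
  haveI : Module.Finite (IwasawaAlgebra p) D.X := D.module_finite_holds hγ
  haveI : (Module.charIdeal (IwasawaAlgebra p) D.X).IsPrincipal := charIdeal_isPrincipal_holds p D.X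
  obtain ⟨fX, hfX⟩ := Submodule.IsPrincipal.principal (Module.charIdeal (IwasawaAlgebra p) D.X)
  have hchar : D.charIdeal = Ideal.span {fX} := hfX
  obtain ⟨hD, a, m, hrel⟩ := isTorsion_and_exists_charGen_mul_eq_C_pow_mul_of_kato W h17 hκ hγ hγ' hord hf D hchar hG
  rcases mordellWeilRank_layer_succ_eq_or_cyclotomicLayer_dvd_charGen W hγ D hD hchar n with h | hdvd
  · exact Or.inl h
  · right
    have h1 := cyclotomicLayer_pow_dvd_of_dvd_C_mul n 1 m (G := G) (by rw [pow_one, ← hrel]; exact dvd_mul_of_dvd_left hdvd a)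
    rwa [pow_one] at h1

/-- ★★ **`rank W(ℚ_n) < rank W(ℚ_{n+1}) ⇒ Φ_{p^{n+1}}(1+T) ∣ L_p`**: growth of the Mordell–Weil rank in the layer `ℚ_{n+1}/ℚ_n` of the cyclotomic `ℤ_p`-tower
makes the `p`-adic `L`-function vanish at EVERY character of `Γ` of exact order `p^{n+1}` (mod PRINT Kato 17.4 (1)(2)). No `μ`, no main conjecture.
[cite: Kato2004Asterisque, Thm. 17.4 (1)(2) (p. 273)] [cite: GreenbergLNM1716, §5 p. 132] -/
theorem cyclotomicLayer_dvd_lift_of_mordellWeilRank_lt {N : ℕ} [NeZero N] {f : CuspForm (Gamma0 N) 2}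
    (h17 : kato_divisibility_allPrimes W p (f := f)) (hord : IsOrdinaryAt W p) (hf : IsNewformOf W f)
    {G : IwasawaAlgebra p} (hG : iwasawaToPowerSeries p G = padicLFunction f (unitRoot W p : ℚ_[p]))
    {κ : ZpExtension ℚ p} {γ : Field.absoluteGaloisGroup ℚ} (hκ : κ.IsCyclotomic) (hγ : κ.IsTopGenerator γ)
    (hγ' : IsCyclotomicVariable p γ) {n : ℕ}
    (hlt : (W.baseChange (κ.layer n)).mordellWeilRank < (W.baseChange (κ.layer (n + 1))).mordellWeilRank) :
    (((Polynomial.cyclotomic (p ^ (n + 1)) ℤ_[p]).comp (Polynomial.X + 1) : ℤ_[p][X]) : PowerSeries ℤ_[p]) ∣ G :=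
  (mordellWeilRank_layer_succ_eq_or_cyclotomicLayer_dvd_lift W h17 hord hf hG hκ hγ hγ' n).resolve_left hlt.ne'

/-- ★ **A jump by `pⁿ(p−1)·t` gives vanishing ORDER `≥ t`: `rank W(ℚ_n) + pⁿ(p−1)·t ≤ rank W(ℚ_{n+1}) ⇒ Φ_{p^{n+1}}(1+T)^t ∣ L_p`.**
[cite: Kato2004Asterisque, Thm. 17.4 (1)(2) (p. 273)] [cite: GreenbergLNM1716, §5 p. 132] -/
theorem cyclotomicLayer_pow_dvd_lift_of_rank_le {N : ℕ} [NeZero N] {f : CuspForm (Gamma0 N) 2}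
    (h17 : kato_divisibility_allPrimes W p (f := f)) (hord : IsOrdinaryAt W p) (hf : IsNewformOf W f)
    {G : IwasawaAlgebra p} (hG : iwasawaToPowerSeries p G = padicLFunction f (unitRoot W p : ℚ_[p]))
    {κ : ZpExtension ℚ p} {γ : Field.absoluteGaloisGroup ℚ} (hκ : κ.IsCyclotomic) (hγ : κ.IsTopGenerator γ)
    (hγ' : IsCyclotomicVariable p γ) (n : ℕ) {t : ℕ}
    (ht : (W.baseChange (κ.layer n)).mordellWeilRank + p ^ n * (p - 1) * t ≤ (W.baseChange (κ.layer (n + 1))).mordellWeilRank) :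
    (((Polynomial.cyclotomic (p ^ (n + 1)) ℤ_[p]).comp (Polynomial.X + 1) : ℤ_[p][X]) : PowerSeries ℤ_[p]) ^ t ∣ G := by
  obtain ⟨D⟩ := W.nonempty_selmerDualData_holds κ γ hγ
  haveI : Module.Finite (IwasawaAlgebra p) D.X := D.module_finite_holds hγ
  haveI : (Module.charIdeal (IwasawaAlgebra p) D.X).IsPrincipal := charIdeal_isPrincipal_holds p D.X
  obtain ⟨fX, hfX⟩ := Submodule.IsPrincipal.principal (Module.charIdeal (IwasawaAlgebra p) D.X)
  have hchar : D.charIdeal = Ideal.span {fX} := hfX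
  obtain ⟨hD, a, m, hrel⟩ := isTorsion_and_exists_charGen_mul_eq_C_pow_mul_of_kato W h17 hκ hγ hγ' hord hf D hchar hG
  have hdvd := cyclotomicLayer_pow_dvd_of_charIdeal_eq_span_of_rank_le W hγ D hD hchar n ht
  exact cyclotomicLayer_pow_dvd_of_dvd_C_mul n t m (G := G) (by rw [← hrel]; exact dvd_mul_of_dvd_left hdvd a)

/-! ## §3 The growth layers have total degree `≤ λ(L_p)`; stationarity beyond an explicit layer -/

/-- ★★ **THE ANALYTIC `λ`-BUDGET: `∑_{n ∈ S} pⁿ(p−1) ≤ λ(G)` for every finite set `S` of layers `n` with `rank W(ℚ_n) < rank W(ℚ_{n+1})`** (`G` any integral lift of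
`L_p(f,α)`; `G ≠ 0` by Rohrlich's theorem, tree `padicLFunction_unitRoot_ne_zero`; the distinct layer primes all divide `G`, companion `sum_totient_le_lam_of_forall_dvd`).
[cite: Kato2004Asterisque, Thm. 17.4 (1)(2) (p. 273)] [cite: RohrlichInventiones1984, Theorem (p. 409)] -/
theorem sum_totient_growthLayers_le_lam_lift {N : ℕ} [NeZero N] {f : CuspForm (Gamma0 N) 2}
    (h17 : kato_divisibility_allPrimes W p (f := f)) (hord : IsOrdinaryAt W p) (hf : IsNewformOf W f)
    {G : IwasawaAlgebra p} (hG : iwasawaToPowerSeries p G = padicLFunction f (unitRoot W p : ℚ_[p]))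
    {κ : ZpExtension ℚ p} {γ : Field.absoluteGaloisGroup ℚ} (hκ : κ.IsCyclotomic) (hγ : κ.IsTopGenerator γ)
    (hγ' : IsCyclotomicVariable p γ) (S : Finset ℕ)
    (hS : ∀ n ∈ S, (W.baseChange (κ.layer n)).mordellWeilRank < (W.baseChange (κ.layer (n + 1))).mordellWeilRank) :
    ∑ n ∈ S, p ^ n * (p - 1) ≤ lam G := by
  have hG0 : G ≠ 0 := by
    intro h0
    rw [h0, map_zero] at hG
    exact padicLFunction_unitRoot_ne_zero hord hf hG.symm
  exact sum_totient_le_lam_of_forall_dvd S hG0 fun n hn ↦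
    cyclotomicLayer_dvd_lift_of_mordellWeilRank_lt W h17 hord hf hG hκ hγ hγ' (hS n hn)

/-- ★ **`λ(G) < pⁿ(p−1) ⇒ rank W(ℚ_{n+1}) = rank W(ℚ_n)`**: no growth at a layer whose degree exceeds the analytic `λ` (any lift `G`; `λ(G) = λ_an` for the `μ`-normalised
lift, and `λ` of any lift differs from it by `0`). [cite: Kato2004Asterisque, Thm. 17.4 (1)(2) (p. 273)] [cite: GreenbergLNM1716, Thm. 1.9 (p. 63)] -/
theorem mordellWeilRank_layer_succ_eq_of_lam_lift_lt {N : ℕ} [NeZero N] {f : CuspForm (Gamma0 N) 2}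
    (h17 : kato_divisibility_allPrimes W p (f := f)) (hord : IsOrdinaryAt W p) (hf : IsNewformOf W f)
    {G : IwasawaAlgebra p} (hG : iwasawaToPowerSeries p G = padicLFunction f (unitRoot W p : ℚ_[p]))
    {κ : ZpExtension ℚ p} {γ : Field.absoluteGaloisGroup ℚ} (hκ : κ.IsCyclotomic) (hγ : κ.IsTopGenerator γ)
    (hγ' : IsCyclotomicVariable p γ) {n : ℕ} (hn : lam G < p ^ n * (p - 1)) :
    (W.baseChange (κ.layer (n + 1))).mordellWeilRank = (W.baseChange (κ.layer n)).mordellWeilRank := by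
  by_contra hne
  have hlt : (W.baseChange (κ.layer n)).mordellWeilRank < (W.baseChange (κ.layer (n + 1))).mordellWeilRank :=
    lt_of_le_of_ne (mordellWeilRank_layer_le_succ W κ n) (Ne.symm hne)
  have h := sum_totient_growthLayers_le_lam_lift W h17 hord hf hG hκ hγ hγ' {n} (by simpa using hlt)
  rw [Finset.sum_singleton] at h
  omega

/-- ★★ **STATIONARY FROM AN EXPLICIT LAYER ON: `λ(G) < p^{n₀}(p−1) ⇒ rank W(ℚ_m) = rank W(ℚ_{n₀})` for every `m ≥ n₀`** — the Mordell–Weil rank of a good ordinary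
`E/ℚ` never grows again in the cyclotomic `ℤ_p`-tower beyond the first layer whose degree exceeds `λ` of (any integral lift of) the `p`-adic `L`-function; modulo
PRINT Kato 17.4 (1)(2) only. (`p = 2`, `λ₂ = 3`: stationary from `ℚ₂` on; `λ₂ ∈ {5,7}`: from `ℚ₃`; `λ₂ ∈ {9,…,15}`: from `ℚ₄`.)
[cite: Kato2004Asterisque, Thm. 17.4 (1)(2) (p. 273)] [cite: GreenbergLNM1716, Thm. 1.9 (p. 63)] -/
theorem mordellWeilRank_layer_eq_of_lam_lift_lt {N : ℕ} [NeZero N] {f : CuspForm (Gamma0 N) 2}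
    (h17 : kato_divisibility_allPrimes W p (f := f)) (hord : IsOrdinaryAt W p) (hf : IsNewformOf W f)
    {G : IwasawaAlgebra p} (hG : iwasawaToPowerSeries p G = padicLFunction f (unitRoot W p : ℚ_[p]))
    {κ : ZpExtension ℚ p} {γ : Field.absoluteGaloisGroup ℚ} (hκ : κ.IsCyclotomic) (hγ : κ.IsTopGenerator γ)
    (hγ' : IsCyclotomicVariable p γ) {n₀ : ℕ} (hn₀ : lam G < p ^ n₀ * (p - 1)) {m : ℕ} (hm : n₀ ≤ m) :
    (W.baseChange (κ.layer m)).mordellWeilRank = (W.baseChange (κ.layer n₀)).mordellWeilRank := by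
  induction m, hm using Nat.le_induction with
  | base => rfl
  | succ m hm ih =>
    have hlt : lam G < p ^ m * (p - 1) :=
      lt_of_lt_of_le hn₀ (Nat.mul_le_mul_right _ (Nat.pow_le_pow_right hp.out.pos hm))
    rw [mordellWeilRank_layer_succ_eq_of_lam_lift_lt W h17 hord hf hG hκ hγ hγ' hlt, ih]

/-- **At the normalised cyclotomic datum** (which exists, tree `exists_isCyclotomic_isTopGenerator_isCyclotomicVariable_holds`): for SOME cyclotomic `ℤ_p`-extension
datum the rank is stationary from `n₀` on; stated as the refutation of every rank certificate `LayerRankGEAt W p m r` with `r > rank W(ℚ_{n₀})`-type growth is left to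
consumers — here the plain existence form. [cite: Kato2004Asterisque, Thm. 17.4 (1)(2) (p. 273)] -/
theorem exists_datum_mordellWeilRank_layer_eq_of_lam_lift_lt {N : ℕ} [NeZero N] {f : CuspForm (Gamma0 N) 2}
    (h17 : kato_divisibility_allPrimes W p (f := f)) (hord : IsOrdinaryAt W p) (hf : IsNewformOf W f)
    {G : IwasawaAlgebra p} (hG : iwasawaToPowerSeries p G = padicLFunction f (unitRoot W p : ℚ_[p]))
    {n₀ : ℕ} (hn₀ : lam G < p ^ n₀ * (p - 1)) :
    ∃ κ : ZpExtension ℚ p, κ.IsCyclotomic ∧ ∀ m, n₀ ≤ m →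
      (W.baseChange (κ.layer m)).mordellWeilRank = (W.baseChange (κ.layer n₀)).mordellWeilRank := by
  obtain ⟨κ, hκ, γ, hγ, hγ'⟩ := exists_isCyclotomic_isTopGenerator_isCyclotomicVariable_holds p
  exact ⟨κ, hκ, fun m hm ↦ mordellWeilRank_layer_eq_of_lam_lift_lt W h17 hord hf hG hκ hγ hγ' hn₀ hm⟩


/-! ## §4 At `p = 2`: the layer prime and the second fixed point together — growth at layer `n+1 ≥ 2` costs `2ⁿ + ord_{T=−2} L₂ ≤ λ₂` -/

section TwoAdic

open Summit.BirchSwinnertonDyer.Rank1Residual.F1Sign2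
  Summit.BirchSwinnertonDyer.BirchSwinnertonDyer.Theorems.AlignedTransportAtTwoTwoFixedPoints
  Summit.BirchSwinnertonDyer.BirchSwinnertonDyer.Theorems.AlignedTransportAtTwoCyclotomicLayerRankBudget

variable (V : WeierstrassCurve ℚ) [V.IsElliptic] [V.IsGloballyMinimal]

/-- (pure `Λ`-algebra, `p = 2`) **`(T+2)^k ∣ G`, `Φ_{2^{n+1}}(1+T) ∣ G`, `n ≥ 1`, `G ≠ 0 ⇒ k + 2ⁿ ≤ λ(G)`**: `T + 2 = Φ₂(1+T)` is the layer-`0` prime and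
`Φ_{2^{n+1}}(1+T)` a different layer prime, so it divides the cofactor `G/(T+2)^k`. [cite: Washington1997, §7.1 and §13.2] -/
theorem add_two_pow_le_lam_of_X_add_C_two_pow_dvd_of_cyclotomicLayer_dvd {G : PowerSeries ℤ_[2]} (hG : G ≠ 0) {k n : ℕ} (hn : 1 ≤ n)
    (hk : (X + C (2 : ℤ_[2])) ^ k ∣ G)
    (hΨ : (((Polynomial.cyclotomic (2 ^ (n + 1)) ℤ_[2]).comp (Polynomial.X + 1) : ℤ_[2][X]) : PowerSeries ℤ_[2]) ∣ G) :
    k + 2 ^ n ≤ lam G := by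
  obtain ⟨G₁, hG₁⟩ := hk
  have hX0 : ((X + C (2 : ℤ_[2])) ^ k : PowerSeries ℤ_[2]) ≠ 0 := pow_ne_zero _ prime_X_add_C_two.ne_zero
  have hG₁0 : G₁ ≠ 0 := by rintro rfl; exact hG (by rw [hG₁, mul_zero])
  have hΨprime := prime_coe_cyclotomic_comp 2 n
  -- `Φ_{2^{n+1}}(1+T)` does not divide `(T+2)^k = Φ₂(1+T)^k` for `n ≥ 1`
  have hΨ1 : (((Polynomial.cyclotomic (2 ^ (n + 1)) ℤ_[2]).comp (Polynomial.X + 1) : ℤ_[2][X]) : PowerSeries ℤ_[2]) ∣ G₁ := by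
    rw [hG₁] at hΨ
    rcases hΨprime.dvd_or_dvd hΨ with h | h
    · exfalso
      have h1 := hΨprime.dvd_of_dvd_pow h
      rw [← AlignedTransportAtTwoLayerOneRankBound.xi_two, ← coe_cyclotomicLayer_zero] at h1
      have := eq_of_cyclotomicLayer_dvd h1
      omega
    · exact h
  obtain ⟨G₂, hG₂⟩ := hΨ1
  have hG₂0 : G₂ ≠ 0 := by rintro rfl; exact hG₁0 (by rw [hG₂, mul_zero])
  rw [hG₁, lam_mul hX0 hG₁0, AlignedTransportAtTwoEisensteinRigidityConservation.lam_X_add_C_two_pow, hG₂,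
    lam_mul hΨprime.ne_zero hG₂0, lam_cyclotomicLayer]
  simp

/-- ★ **`p = 2`, any good ordinary `W/ℚ` (PRINT `h17`): growth of the Mordell–Weil rank in the layer `ℚ_{n+1}/ℚ_n` (`n ≥ 1`) forces `ord_{T=−2} L₂ + 2ⁿ ≤ λ(G)`**
for every integral lift `G` of `L₂(f,α)` with `ord_{T=−2} G = k` (tree `HasOrderAtNegTwo`): the zero at the order-`2` character `χ₈` (the second fixed point, g32/g33) and the
full orbit of zeros at the characters of order `2^{n+1}` are DISTINCT prime factors of `L₂`. On the `a₂ = −1` road (`ord ∈ {1,3}`, g33) growth at layer `n+1` thus needs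
`λ₂ ≥ 2ⁿ + 1`, resp. `2ⁿ + 3`. [cite: Kato2004Asterisque, Thm. 17.4 (1)(2) (p. 273)] [cite: GreenbergLNM1716, §5 p. 132 and p. 177] -/
theorem orderAtNegTwo_add_two_pow_le_lam_of_mordellWeilRank_lt {N : ℕ} [NeZero N] {f : CuspForm (Gamma0 N) 2}
    (h17 : kato_divisibility_allPrimes V 2 (f := f)) (hord : IsOrdinaryAt V 2) (hf : IsNewformOf V f)
    {G : IwasawaAlgebra 2} (hG : iwasawaToPowerSeries 2 G = padicLFunction f (unitRoot V 2 : ℚ_[2])) {k : ℕ} (hk : HasOrderAtNegTwo G k)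
    {κ : ZpExtension ℚ 2} {γ : Field.absoluteGaloisGroup ℚ} (hκ : κ.IsCyclotomic) (hγ : κ.IsTopGenerator γ)
    (hγ' : IsCyclotomicVariable 2 γ) {n : ℕ} (hn : 1 ≤ n)
    (hlt : (V.baseChange (κ.layer n)).mordellWeilRank < (V.baseChange (κ.layer (n + 1))).mordellWeilRank) :
    k + 2 ^ n ≤ lam G := by
  have hG0 : G ≠ 0 := by
    intro h0
    rw [h0, map_zero] at hG
    exact padicLFunction_unitRoot_ne_zero hord hf hG.symm
  exact add_two_pow_le_lam_of_X_add_C_two_pow_dvd_of_cyclotomicLayer_dvd hG0 hn hk.1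
    (cyclotomicLayer_dvd_lift_of_mordellWeilRank_lt V h17 hord hf hG hκ hγ hγ' hlt)

/-- **Contrapositive at `p = 2`: `λ(G) < ord_{T=−2} G + 2ⁿ` (`n ≥ 1`) ⇒ `rank W(ℚ_{n+1}) = rank W(ℚ_n)`.** E.g. on the `a₂ = −1` road with `ord₋₂ = 3` and
`λ₂ = 5`: `5 < 3 + 4` kills growth at every layer `n+1 ≥ 3`, so the rank can grow above `ℚ(√2)` only in `ℚ₂/ℚ₁`.
[cite: Kato2004Asterisque, Thm. 17.4 (1)(2) (p. 273)] [cite: GreenbergLNM1716, §5 p. 177] -/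
theorem mordellWeilRank_layer_succ_eq_of_lam_lt_orderAtNegTwo_add {N : ℕ} [NeZero N] {f : CuspForm (Gamma0 N) 2}
    (h17 : kato_divisibility_allPrimes V 2 (f := f)) (hord : IsOrdinaryAt V 2) (hf : IsNewformOf V f)
    {G : IwasawaAlgebra 2} (hG : iwasawaToPowerSeries 2 G = padicLFunction f (unitRoot V 2 : ℚ_[2])) {k : ℕ} (hk : HasOrderAtNegTwo G k)
    {κ : ZpExtension ℚ 2} {γ : Field.absoluteGaloisGroup ℚ} (hκ : κ.IsCyclotomic) (hγ : κ.IsTopGenerator γ)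
    (hγ' : IsCyclotomicVariable 2 γ) {n : ℕ} (hn : 1 ≤ n) (hlam : lam G < k + 2 ^ n) :
    (V.baseChange (κ.layer (n + 1))).mordellWeilRank = (V.baseChange (κ.layer n)).mordellWeilRank := by
  by_contra hne
  have hlt : (V.baseChange (κ.layer n)).mordellWeilRank < (V.baseChange (κ.layer (n + 1))).mordellWeilRank :=
    lt_of_le_of_ne (mordellWeilRank_layer_le_succ V κ n) (Ne.symm hne)
  have h := orderAtNegTwo_add_two_pow_le_lam_of_mordellWeilRank_lt V h17 hord hf hG hk hκ hγ hγ' hn hlt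
  omega

end TwoAdic

end Summit.BirchSwinnertonDyer.BirchSwinnertonDyer.Theorems.AlignedTransportAtTwoCyclotomicLayerLFunction
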